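import Mathlib.RingTheory.Unramified.LocalStructure
import Mathlib.RingTheory.Smooth.StandardSmoothCotangent
import Mathlib.RingTheory.Extension.Presentation.Submersive
import Literature.ModelTheory.PseudofiniteFields.EtaleOpenTopology
import HarnessLib

/-!
# Étale images in the affine line: the local structure argument

Topic `Literature/ModelTheory/PseudofiniteFields`.  For an étale datum `D` over `𝔸¹_K`
(`EtaleDatum K 1 r`: equations `G_1, …, G_r`, localisation `H`, in `K[x, t_1, …, t_r]`) we prove

* `EtaleDatum.image_infinite_of_nonempty_of_planeCurves` — **a nonempty étale image in the line
  is infinite**, GRANTED the plane-curve input `hPC` over the same field `K`: for all monic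
  `F ∈ K[s][u]`, all `Q`, and `(a, b)` with `F(a,b) = 0`, `∂_u F(a,b) ≠ 0`, `Q(a,b) ≠ 0`, the set
  `{F = 0, Q ≠ 0} ⊆ K²` is infinite.  (Over a pseudo-finite field `hPC` holds —
  `PlaneCurvesPseudofinite.lean` — and the conclusion is the case `V = 𝔸¹` of
  Johnson–Tran–Walsberg–Ye's Theorem 7.1; the general case is deduced in
  `EtaleOpenTopologyProofs.lean`.)

The proof is the local structure theorem for étale algebras [Stacks 00UE] in Mathlib's form
`Algebra.IsEtaleAt.exists_isStandardEtale`: the coordinate ring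
`A = K[s][t, z]/(G(s,t), z·H(s,t)J(s,t) − 1)` of the datum (`LineAlg`, with `x ↦ s`) is standard
smooth of relative dimension `0` over `K[s]` — its naive presentation is submersive, the Jacobian
being block triangular with determinant `J · HJ`, a unit (`linePres_jacobiMatrix_det`) — hence
étale; so near the prime of a `K`-point it is standard étale, `A[1/f] ≅ K[s][u]_g/(F)` with `F`
monic in `u` and `∂_u F` invertible.  `K`-points of `A` over `s = a` are `K[s]`-algebra maps into
`PointAlg K a` (`K` with `s ↦ a`; `nonempty_algHom_of_eval`, `mem_image_of_algHom`), and those of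
`K[s][u]_g/(F)` are the points of the plane curve `{F = 0, g ≠ 0}` (`hasMap_of_evalEval`); the
given point of the image yields a non-singular point of that curve, `hPC` yields infinitely many,
and they map back to infinitely many points of the image (the fibres of `{F = 0} → 𝔸¹` being
finite as `F` is monic).

Genuine definitions: `lineSubst`, `lineRel`, `LineAlg`, `linePres`, `lineSubPres`, `PointAlg`
(a type synonym of `K` with its `K[s]`-algebra structure "evaluate at `a`"), `PointAlg.val`.
No named facts.

## References

* The Stacks Project, Tag 00UE (étale ring maps are standard étale locally); Mathlib
  `Mathlib.RingTheory.Unramified.LocalStructure`. [folklore]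
* W. Johnson, C.-M. Tran, E. Walsberg, J. Ye, *The étale-open topology and the stable fields
  conjecture*, J. Eur. Math. Soc. 26 (2024) 4033–4070, §1 and Thm 7.1. [JohnsonTranWalsbergYe2024]
-/

namespace Literature.ModelTheory.PseudofiniteFields

namespace EtaleDatum

open MvPolynomial

variable {K : Type} [Field K] {r : ℕ}

/-- The substitution `x ↦ s` (the base-ring variable), `t_j ↦ T_j`, from `K[x, t]` to
`K[s][T, z]`. [folklore] -/
noncomputable def lineSubst (K : Type) [Field K] (r : ℕ) :
    MvPolynomial (Fin 1 ⊕ Fin r) K →ₐ[K] MvPolynomial (Fin r ⊕ Unit) (Polynomial K) :=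
  MvPolynomial.aeval (Sum.elim (fun _ => C Polynomial.X) (fun j => X (Sum.inl j)))

/-- `lineSubst` on the base variable. [folklore] -/
@[simp] theorem lineSubst_X_inl (i : Fin 1) :
    lineSubst K r (X (Sum.inl i)) = C Polynomial.X := by
  simp [lineSubst]

/-- `lineSubst` on the auxiliary variables. [folklore] -/
@[simp] theorem lineSubst_X_inr (j : Fin r) :
    lineSubst K r (X (Sum.inr j)) = X (Sum.inl j) := by
  simp [lineSubst]

/-- `lineSubst` on constants. [folklore] -/
@[simp] theorem lineSubst_C (a : K) :
    lineSubst K r (C a) = C (Polynomial.C a) := by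
  simp [lineSubst]

/-- Substituted polynomials do not involve the Rabinowitsch variable `z`. [folklore] -/
theorem pderiv_inr_lineSubst (p : MvPolynomial (Fin 1 ⊕ Fin r) K) :
    pderiv (Sum.inr ()) (lineSubst K r p) = 0 := by
  induction p using MvPolynomial.induction_on with
  | C a => simp
  | add p q hp hq => simp [hp, hq]
  | mul_X p s hp =>
    rcases s with i | j
    · simp [hp]
    · simp [hp]

/-- Chain rule: `∂/∂T_j ∘ lineSubst = lineSubst ∘ ∂/∂t_j`. [folklore] -/
theorem pderiv_inl_lineSubst (j : Fin r) (p : MvPolynomial (Fin 1 ⊕ Fin r) K) :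
    pderiv (Sum.inl j) (lineSubst K r p) = lineSubst K r (pderiv (Sum.inr j) p) := by
  induction p using MvPolynomial.induction_on with
  | C a => simp
  | add p q hp hq => simp [hp, hq]
  | mul_X p s hp =>
    rcases s with i | j'
    · simp [hp]
    · by_cases h : j' = j
      · subst h; simp [hp]
      · simp [hp, h, pderiv_X_of_ne (show (Sum.inl j' : Fin r ⊕ Unit) ≠ Sum.inl j from
          fun e => h (Sum.inl_injective e))]

/-- The relations of the line algebra of `D`: the substituted equations and the Rabinowitsch
relation `z · (H J) - 1`. [folklore] -/
noncomputable def lineRel (D : EtaleDatum K 1 r) :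
    Fin r ⊕ Unit → MvPolynomial (Fin r ⊕ Unit) (Polynomial K) :=
  Sum.elim (fun i => lineSubst K r (D.G i))
    (fun _ => X (Sum.inr ()) * lineSubst K r (D.H * D.jacobianDet) - 1)

/-- The line algebra `K[s][T, z]/(G(s,T), z H(s,T) J(s,T) - 1)` of an étale datum over `𝔸¹`:
the coordinate ring of `{G = 0, HJ ≠ 0}` as a `K[s]`-algebra. [folklore] -/
abbrev LineAlg (D : EtaleDatum K 1 r) : Type :=
  MvPolynomial (Fin r ⊕ Unit) (Polynomial K) ⧸ Ideal.span (Set.range (lineRel D))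

/-- The naive presentation of `LineAlg D` (generators `T, z`, relations `lineRel D`).
[folklore] -/
noncomputable def linePres (D : EtaleDatum K 1 r) :
    Algebra.PreSubmersivePresentation (Polynomial K) (LineAlg D) (Fin r ⊕ Unit) (Fin r ⊕ Unit) :=
  .naive (v := lineRel D) id Function.injective_id

/-- The Jacobian matrix of the naive presentation is block triangular: `∂G/∂T` (transposed,
substituted), and `HJ` for the Rabinowitsch relation. [folklore] -/
theorem linePres_jacobiMatrix (D : EtaleDatum K 1 r) :
    (linePres D).jacobiMatrix = Matrix.fromBlocks
      (((Matrix.of fun i j : Fin r => pderiv (Sum.inr j) (D.G i)).transpose).map (lineSubst K r))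
      (Matrix.of fun i _ => pderiv (Sum.inl i) (lineRel D (Sum.inr ())))
      0
      (Matrix.of fun _ _ => lineSubst K r (D.H * D.jacobianDet)) := by
  ext i j
  rw [linePres, Algebra.PreSubmersivePresentation.jacobiMatrix_naive]
  rcases i with i | ⟨⟨⟩⟩ <;> rcases j with j | ⟨⟨⟩⟩
  · simp [lineRel, pderiv_inl_lineSubst]
  · simp
  · simp [lineRel, pderiv_inr_lineSubst]
  · simp [lineRel, pderiv_inr_lineSubst]

/-- Its determinant is `J · (H J)` (substituted). [folklore] -/
theorem linePres_jacobiMatrix_det (D : EtaleDatum K 1 r) :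
    (linePres D).jacobiMatrix.det =
      lineSubst K r D.jacobianDet * lineSubst K r (D.H * D.jacobianDet) := by
  rw [linePres_jacobiMatrix, Matrix.det_fromBlocks_zero₂₁]
  congr 1
  · rw [jacobianDet, AlgHom.map_det, AlgHom.mapMatrix_apply, ← Matrix.det_transpose]
    rfl
  · rw [Matrix.det_unique, Matrix.of_apply]

/-- The Jacobian of the naive presentation is a unit of `LineAlg D` (`z · HJ = 1` there).
[folklore] -/
theorem isUnit_jacobian_linePres (D : EtaleDatum K 1 r) : IsUnit (linePres D).jacobian := by
  rw [Algebra.PreSubmersivePresentation.jacobian_eq_jacobiMatrix_det, linePres_jacobiMatrix_det]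
  have h1 : (Ideal.Quotient.mk (Ideal.span (Set.range (lineRel D))))
      (X (Sum.inr ()) * lineSubst K r (D.H * D.jacobianDet) - 1) = 0 :=
    Ideal.Quotient.eq_zero_iff_mem.2 (Ideal.subset_span ⟨Sum.inr (), rfl⟩)
  have h2 : IsUnit ((Ideal.Quotient.mk (Ideal.span (Set.range (lineRel D))))
      (lineSubst K r (D.H * D.jacobianDet))) := by
    rw [map_sub, map_one, sub_eq_zero, map_mul] at h1
    exact IsUnit.of_mul_eq_one_right _ h1
  have h3 : IsUnit ((Ideal.Quotient.mk (Ideal.span (Set.range (lineRel D))))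
      (lineSubst K r D.jacobianDet)) := by
    rw [map_mul, map_mul] at h2
    exact isUnit_of_mul_isUnit_right h2
  change IsUnit ((Ideal.Quotient.mk (Ideal.span (Set.range (lineRel D)))) _)
  rw [map_mul]
  exact h3.mul h2

/-- The naive presentation of `LineAlg D` is submersive. [folklore] -/
noncomputable def lineSubPres (D : EtaleDatum K 1 r) :
    Algebra.SubmersivePresentation (Polynomial K) (LineAlg D) (Fin r ⊕ Unit) (Fin r ⊕ Unit) :=
  { linePres D with jacobian_isUnit := isUnit_jacobian_linePres D }

/-- `LineAlg D` is standard smooth of relative dimension `0` over `K[s]`. [folklore] -/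
instance (D : EtaleDatum K 1 r) :
    Algebra.IsStandardSmoothOfRelativeDimension 0 (Polynomial K) (LineAlg D) :=
  (lineSubPres D).isStandardSmoothOfRelativeDimension (by simp [Algebra.Presentation.dimension])

/-- Hence `LineAlg D` is étale over `K[s]` (Mathlib: standard smooth of relative dimension `0`
implies étale). [folklore] -/
instance (D : EtaleDatum K 1 r) : Algebra.Etale (Polynomial K) (LineAlg D) := inferInstance

/-- `LineAlg D` is finitely presented over `K[s]`. [folklore] -/
instance (D : EtaleDatum K 1 r) : Algebra.FinitePresentation (Polynomial K) (LineAlg D) :=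
  (lineSubPres D).finitePresentation_of_isFinite

/-- An étale algebra is étale at every prime. [folklore] -/
theorem _root_.Literature.ModelTheory.PseudofiniteFields.isEtaleAt_of_etale
    {R A : Type*} [CommRing R] [CommRing A] [Algebra R A] [Algebra.Etale R A]
    (Q : Ideal A) [Q.IsPrime] : Algebra.IsEtaleAt R Q := by
  unfold Algebra.IsEtaleAt
  have : Algebra.FormallyEtale A (Localization.AtPrime Q) :=
    Algebra.FormallyEtale.of_isLocalization Q.primeCompl
  exact Algebra.FormallyEtale.comp R A _

/-- **Local structure**: an étale algebra is standard étale near every prime (Mathlib's form of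
Stacks 00UE, `Algebra.IsEtaleAt.exists_isStandardEtale`). [folklore] -/
theorem _root_.Literature.ModelTheory.PseudofiniteFields.exists_isStandardEtale_of_etale
    {R A : Type*} [CommRing R] [CommRing A] [Algebra R A] [Algebra.Etale R A]
    (Q : Ideal A) [Q.IsPrime] : ∃ f, f ∉ Q ∧ Algebra.IsStandardEtale R (Localization.Away f) := by
  have := isEtaleAt_of_etale (R := R) Q
  exact Algebra.IsEtaleAt.exists_isStandardEtale (R := R) Q

end EtaleDatum

end Literature.ModelTheory.PseudofiniteFields

namespace Literature.ModelTheory.PseudofiniteFields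

open MvPolynomial Polynomial
open scoped Polynomial.Bivariate

/-- `K` regarded as a `K[s]`-algebra through the evaluation `s ↦ a` (a type synonym, so that
`K`-points over `s = a` are `K[s]`-algebra maps). [folklore] -/
def PointAlg (K : Type) [Field K] (_a : K) : Type := K

namespace PointAlg

variable {K : Type} [Field K] {a : K}

/-- `PointAlg K a` is the field `K`. [folklore] -/
instance : Field (PointAlg K a) := inferInstanceAs (Field K)

/-- The `K[s]`-algebra structure "evaluate at `a`" on `PointAlg K a`. [folklore] -/
noncomputable instance : Algebra (Polynomial K) (PointAlg K a) :=
  (Polynomial.evalRingHom a).toAlgebra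

/-- The identification `PointAlg K a = K`. [folklore] -/
def val : PointAlg K a →+* K := RingHom.id K

/-- The structure map of `PointAlg K a` is evaluation at `a`. [folklore] -/
theorem algebraMap_apply (p : Polynomial K) :
    val (algebraMap (Polynomial K) (PointAlg K a) p) = p.eval a := rfl

/-- `aeval` into `PointAlg K a` is two-variable evaluation at `(a, b)`. [folklore] -/
theorem val_aeval (b : PointAlg K a) (F : K[X][Y]) :
    val (Polynomial.aeval b F) = F.evalEval a (val b) :=
  (Polynomial.aeval_def b F).trans (congrFun (congrFun (eval₂_evalRingHom a) b) F)

end PointAlg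

namespace EtaleDatum

variable {K : Type} [Field K] {r : ℕ}

/-- Evaluating the substituted polynomial at `(t, z)` over the point `a` is evaluating the
original polynomial at `(a, t)`. [folklore] -/
theorem val_aeval_lineSubst (a : K) (g : Fin r ⊕ Unit → PointAlg K a)
    (p : MvPolynomial (Fin 1 ⊕ Fin r) K) :
    PointAlg.val (MvPolynomial.aeval g (lineSubst K r p)) =
      MvPolynomial.eval (Sum.elim (fun _ => a) (fun j => PointAlg.val (g (Sum.inl j)))) p := by
  induction p using MvPolynomial.induction_on with
  | C c =>
    rw [lineSubst_C, MvPolynomial.aeval_C, PointAlg.algebraMap_apply, Polynomial.eval_C,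
      MvPolynomial.eval_C]
  | add p q hp hq => rw [map_add, map_add, map_add, map_add, hp, hq]
  | mul_X p s hp =>
    rw [map_mul, map_mul, map_mul, map_mul, hp, MvPolynomial.eval_X]
    congr 1
    rcases s with i | j
    · rw [lineSubst_X_inl, MvPolynomial.aeval_C, PointAlg.algebraMap_apply, Polynomial.eval_X,
        Sum.elim_inl]
    · rw [lineSubst_X_inr, MvPolynomial.aeval_X, Sum.elim_inr]

/-- A point `(a, t)` of the datum gives a `K[s]`-algebra map `LineAlg D → PointAlg K a`
(`T ↦ t`, `z ↦ (HJ)(a,t)⁻¹`). [folklore] -/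
theorem nonempty_algHom_of_eval {D : EtaleDatum K 1 r} {a : K} {t : Fin r → K}
    (hG : ∀ i, MvPolynomial.eval (Sum.elim (fun _ => a) t) (D.G i) = 0)
    (hH : MvPolynomial.eval (Sum.elim (fun _ => a) t) D.H ≠ 0)
    (hJ : MvPolynomial.eval (Sum.elim (fun _ => a) t) D.jacobianDet ≠ 0) :
    Nonempty (LineAlg D →ₐ[Polynomial K] PointAlg K a) := by
  set u : K := MvPolynomial.eval (Sum.elim (fun _ => a) t) (D.H * D.jacobianDet) with hu
  have hu0 : u ≠ 0 := by rw [hu, map_mul]; exact mul_ne_zero hH hJ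
  let g : Fin r ⊕ Unit → PointAlg K a := Sum.elim (fun j => (t j : K)) (fun _ => (u⁻¹ : K))
  have hg : ∀ p, PointAlg.val (MvPolynomial.aeval g (lineSubst K r p)) =
      MvPolynomial.eval (Sum.elim (fun _ => a) t) p := fun p => by
    rw [val_aeval_lineSubst]; rfl
  refine ⟨Ideal.Quotient.liftₐ _ (MvPolynomial.aeval g) ?_⟩
  intro p hp
  refine Submodule.span_induction ?_ (by simp) (fun _ _ _ _ h₁ h₂ => by simp [h₁, h₂])
    (fun c _ _ h => by simp [h]) hp
  rintro _ ⟨i, rfl⟩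
  apply PointAlg.val.injective
  rw [map_zero]
  rcases i with i | ⟨⟨⟩⟩
  · change PointAlg.val (MvPolynomial.aeval g (lineSubst K r (D.G i))) = 0
    rw [hg]; exact hG i
  · change PointAlg.val (MvPolynomial.aeval g
      (X (Sum.inr ()) * lineSubst K r (D.H * D.jacobianDet) - 1)) = 0
    rw [map_sub, map_one, map_mul, MvPolynomial.aeval_X, map_sub, map_one, map_mul, hg, ← hu,
      sub_eq_zero]
    exact inv_mul_cancel₀ hu0

/-- A point of the image gives a `K[s]`-algebra map `LineAlg D → PointAlg K (x 0)`. [folklore] -/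
theorem nonempty_algHom_of_mem_image {D : EtaleDatum K 1 r} {x : Fin 1 → K} (hx : x ∈ D.image) :
    Nonempty (LineAlg D →ₐ[Polynomial K] PointAlg K (x 0)) := by
  obtain ⟨t, hG, hH, hJ⟩ := hx
  have hx' : Sum.elim x t = Sum.elim (fun _ => x 0) t := by
    ext s; rcases s with i | j
    · simp [Fin.fin_one_eq_zero i]
    · simp
  rw [hx'] at hG hH hJ
  exact nonempty_algHom_of_eval hG hH hJ

/-- Conversely a `K[s]`-algebra map `LineAlg D → PointAlg K a` gives a point of the image over
`a` (the images of `T_j`). [folklore] -/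
theorem mem_image_of_algHom {D : EtaleDatum K 1 r} {a : K}
    (ψ : LineAlg D →ₐ[Polynomial K] PointAlg K a) : (fun _ => a) ∈ D.image := by
  let t : Fin r → K := fun j => PointAlg.val (ψ (Ideal.Quotient.mk _ (X (Sum.inl j))))
  have hcomp : ∀ p, ψ (Ideal.Quotient.mk _ p) =
      MvPolynomial.aeval (fun s => ψ (Ideal.Quotient.mk _ (X s))) p := fun p => by
    have : (ψ.comp (Ideal.Quotient.mkₐ (Polynomial K) _)) =
        MvPolynomial.aeval (fun s => ψ (Ideal.Quotient.mk _ (X s))) :=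
      MvPolynomial.algHom_ext fun s => by simp
    exact congrArg (fun φ : MvPolynomial (Fin r ⊕ Unit) (Polynomial K) →ₐ[Polynomial K]
      PointAlg K a => φ p) this
  have hg : ∀ p, PointAlg.val (ψ (Ideal.Quotient.mk _ (lineSubst K r p))) =
      MvPolynomial.eval (Sum.elim (fun _ => a) t) p := fun p => by
    rw [hcomp, val_aeval_lineSubst]
  have hzero : ∀ i, ψ (Ideal.Quotient.mk _ (lineRel D i)) = 0 := fun i =>
    (congrArg ψ (Ideal.Quotient.eq_zero_iff_mem.2 (Ideal.subset_span ⟨i, rfl⟩))).trans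
      (map_zero ψ)
  refine (mem_image_iff D _).2 ⟨t, fun i => ?_, ?_⟩
  · have h1 : ψ (Ideal.Quotient.mk _ (lineSubst K r (D.G i))) = 0 := hzero (Sum.inl i)
    rw [← hg, h1, map_zero]
  · have h1 : ψ (Ideal.Quotient.mk _ (X (Sum.inr ()) * lineSubst K r (D.H * D.jacobianDet) - 1))
        = 0 := hzero (Sum.inr ())
    simp only [map_sub, map_one, map_mul] at h1
    have h3 := congrArg PointAlg.val h1
    simp only [map_sub, map_one, map_mul, map_zero, hg] at h3
    rw [sub_eq_zero] at h3
    have h4 : MvPolynomial.eval (Sum.elim (fun _ => a) t) D.H *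
        MvPolynomial.eval (Sum.elim (fun _ => a) t) D.jacobianDet ≠ 0 := by
      intro h0; rw [h0, mul_zero] at h3; exact zero_ne_one h3
    exact ⟨left_ne_zero_of_mul h4, right_ne_zero_of_mul h4⟩

end EtaleDatum

end Literature.ModelTheory.PseudofiniteFields

namespace Literature.ModelTheory.PseudofiniteFields

open MvPolynomial Polynomial
open scoped Polynomial.Bivariate

namespace EtaleDatum

variable {K : Type} [Field K] {r : ℕ}

/-- Points of a standard étale pair `K[s][u]_g/(f)` with values in `PointAlg K a`: a pair
`(a, b)` with `f(a, b) = 0`, `g(a, b) ≠ 0` gives `HasMap b`. [folklore] -/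
theorem hasMap_of_evalEval (P : StandardEtalePair (Polynomial K)) {a b : K}
    (hf : P.f.evalEval a b = 0) (hg : P.g.evalEval a b ≠ 0) :
    P.HasMap (show PointAlg K a from b) := by
  constructor
  · apply PointAlg.val.injective
    rw [PointAlg.val_aeval, map_zero]; exact hf
  · rw [isUnit_iff_ne_zero]
    intro h0
    apply hg
    have := congrArg PointAlg.val h0
    rwa [PointAlg.val_aeval, map_zero] at this

/-- Conversely `HasMap b` over `a` means `f(a,b) = 0`, `g(a,b) ≠ 0`, and then `∂_u f(a,b) ≠ 0`
(`StandardEtalePair.HasMap.isUnit_derivative_f`). [folklore] -/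
theorem evalEval_of_hasMap (P : StandardEtalePair (Polynomial K)) {a : K} {b : PointAlg K a}
    (h : P.HasMap b) :
    P.f.evalEval a (PointAlg.val b) = 0 ∧ P.g.evalEval a (PointAlg.val b) ≠ 0 ∧
      (derivative P.f).evalEval a (PointAlg.val b) ≠ 0 := by
  refine ⟨?_, ?_, ?_⟩
  · rw [← PointAlg.val_aeval, h.1, map_zero]
  · rw [← PointAlg.val_aeval]
    exact fun h0 => (h.2.ne_zero) (PointAlg.val.injective (h0.trans (map_zero _).symm))
  · rw [← PointAlg.val_aeval]
    exact fun h0 => (h.isUnit_derivative_f.ne_zero)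
      (PointAlg.val.injective (h0.trans (map_zero _).symm))

/-- **A nonempty étale image in the affine line is infinite**, granted the plane-curve input
`hPC` over the given field `K` (for monic `F ∈ K[s][u]`, a point `(a,b)` with `F(a,b) = 0`,
`∂_u F(a,b) ≠ 0`, `Q(a,b) ≠ 0` forces `{F = 0, Q ≠ 0}` to be infinite): for every étale datum
`D` over `𝔸¹_K`, if `D.image ≠ ∅` then `D.image` is infinite.  (Local structure of étale algebras
+ points of standard étale pairs, see the module docstring.)
[cite: JohnsonTranWalsbergYe2024, Thm 7.1 (case `V = 𝔸¹`, given PAC for plane curves)] -/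
theorem image_infinite_of_nonempty_of_planeCurves
    (hPC : ∀ (F Q : K[X][Y]) (a b : K), F.Monic → F.evalEval a b = 0 →
      (derivative F).evalEval a b ≠ 0 → Q.evalEval a b ≠ 0 →
      {p : K × K | F.evalEval p.1 p.2 = 0 ∧ Q.evalEval p.1 p.2 ≠ 0}.Infinite)
    (D : EtaleDatum K 1 r) (hne : D.image.Nonempty) : D.image.Infinite := by
  classical
  obtain ⟨x₀, hx₀⟩ := hne
  obtain ⟨ψ₀⟩ := nonempty_algHom_of_mem_image hx₀
  -- the prime of the point and a standard étale neighbourhood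
  let Q : Ideal (LineAlg D) := RingHom.ker ψ₀
  haveI : Q.IsPrime := RingHom.ker_isPrime ψ₀
  obtain ⟨f, hfQ, hstd⟩ := exists_isStandardEtale_of_etale (R := Polynomial K) (A := LineAlg D) Q
  obtain ⟨E⟩ := hstd.nonempty_standardEtalePresentation
  -- lift the point to the localisation and read it in the presentation
  have hunit : ∀ y : Submonoid.powers f, IsUnit (ψ₀ y) := by
    rintro ⟨y, n, rfl⟩
    rw [map_pow]
    exact IsUnit.pow _ (isUnit_iff_ne_zero.2 hfQ)
  let ψ₀' : Localization.Away f →ₐ[Polynomial K] PointAlg K (x₀ 0) :=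
    IsLocalization.liftAlgHom (M := Submonoid.powers f) hunit
  let φ₀ : E.Ring →ₐ[Polynomial K] PointAlg K (x₀ 0) := ψ₀'.comp E.equivRing.symm.toAlgHom
  obtain ⟨hf0, hg0, hd0⟩ :=
    evalEval_of_hasMap E.P ((StandardEtalePair.hasMap_X (P := E.P)).map φ₀)
  -- the plane-curve input
  have hinf := hPC E.f E.g (x₀ 0) _ E.monic_f hf0 hd0 hg0
  set S := {p : K × K | E.f.evalEval p.1 p.2 = 0 ∧ E.g.evalEval p.1 p.2 ≠ 0} with hS
  -- every point of `S` gives a point of the image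
  have hpt : ∀ p ∈ S, (fun _ => p.1 : Fin 1 → K) ∈ D.image := by
    rintro ⟨a, b⟩ ⟨hfab, hgab⟩
    let φ : E.Ring →ₐ[Polynomial K] PointAlg K a :=
      E.P.lift _ (hasMap_of_evalEval E.P hfab hgab)
    exact mem_image_of_algHom ((φ.comp E.equivRing.toAlgHom).comp
      (IsScalarTower.toAlgHom (Polynomial K) (LineAlg D) (Localization.Away f)))
  -- the first projection of `S` is infinite (the fibres of `S → K` are finite since `f` is monic)
  have hfst : (Prod.fst '' S).Infinite := by
    intro hfin
    apply hinf
    have hsub : S ⊆ ⋃ a ∈ Prod.fst '' S, (fun b => (a, b)) '' {b | (E.f.map (evalRingHom a)).IsRoot b} := by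
      rintro ⟨a, b⟩ hab
      simp only [Set.mem_iUnion, Set.mem_image, Set.mem_setOf_eq, Prod.exists, exists_and_right,
        exists_eq_right, Prod.mk.injEq]
      refine ⟨a, ⟨b, hab⟩, b, ?_, rfl, rfl⟩
      rw [IsRoot, Polynomial.eval_map, eval₂_evalRingHom]
      exact hab.1
    refine Set.Finite.subset (Set.Finite.biUnion hfin fun a _ => Set.Finite.image _ ?_) hsub
    exact Polynomial.finite_setOf_isRoot ((E.monic_f.map (evalRingHom a)).ne_zero)
  -- conclude
  have himg : (fun a : K => (fun _ => a : Fin 1 → K)) '' (Prod.fst '' S) ⊆ D.image := by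
    rintro _ ⟨a, ⟨p, hp, rfl⟩, rfl⟩
    exact hpt p hp
  refine Set.Infinite.mono himg (hfst.image ?_)
  exact Set.injOn_of_injective (fun a b h => by simpa using congrFun h 0)

end EtaleDatum

end Literature.ModelTheory.PseudofiniteFields
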